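import Summits.CriticalPhenomena.PercolationContinuityZ3.Theorems.Transplant.GridCoverRigidity
import Summits.CriticalPhenomena.PercolationContinuityZ3.Theorems.Transplant.PlanarSkeletonFrmScaledDefs
import HarnessLib

/-!
# The LONSDALEITE net (`lon`, hexagonal diamond) carries NO planar unit-step skeleton — `PlanarSkeletonFrm`, `PlanarSkeletonNeg`,
# `PlanarSkeletonSign`, `PlanarSkeletonConc` are all EMPTY, for EVERY chart, base set and frame family (a kernel method-void certificate)

builds on p205010 (kernel theorem, internal audit signed; external expert review pending) — nothing in this file uses p205010.
Lane `prim-bschramm`, seat `prim-bschramm-p4` (gen 19; PART C3, `HOME/bschramm/P4-GENERAL.md` §41: the multi-type wall made exact).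
Helper file (`--supports stmt-CriticalPhenomena-4575 --as helper`).

THE NET.  Lonsdaleite = buckled honeycomb bilayers `D_k ∪ U_k` stacked along `c` with the bilayers related by a `c`-glide (AB stacking), so
that the inter-bilayer bonds are ECLIPSED.  Integer model on `ℤ³ ∋ (i, j, m)`: `(i, j)` are triangular-lattice coordinates, `m = 2k` is the
lower sheet `D_k`, `m = 2k + 1` the upper sheet `U_k` of bilayer `k`; in-layer bonds `D_k(h) ∼ U_k(h + w)` for `w ∈ {0, (1,0), (0,1)}` (`k` even)
resp. `w ∈ {0, (−1,0), (0,−1)}` (`k` odd — the glide reverses the bond star), vertical bonds `U_k(h) ∼ D_{k+1}(h)`.  The bond table depends on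
`m mod 4` (`Lon.bonds`); the graph `Lon.graph` is 4-regular (`Lon.degree_eq`) and its coordination sequence `4, 12, 25, 44, 67, 96, 130, …` is that
of RCSR `lon` (checked numerically in the seat, `HOME/prim-bschramm-p4-g19/cover/`; the diamond net — uniform bond star — has `4, 12, 24, 42, …`).
THE CERTIFICATE.  The path `D₀(0) ∼ U₀(0) ∼ D₁(0) ∼ U₁(0)` (in-layer, vertical, in-layer: `(0,0,0) ∼ (0,0,1) ∼ (0,0,2) ∼ (0,0,3)`) lies on the two
boat hexagons closing through `(1,0,2), (1,0,1)` and through `(0,1,2), (0,1,1)` (`Lon.threePathConfig`).  By THREE-PATH RIGIDITY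
(`GridCoverRigidity`: a closed non-backtracking 6-walk of unit steps in `ℤ²` is a `2 × 1` rectangle, so its fourth step is minus its first, and
labels at a degree-4 vertex are injective) no `φ : V → ℤ²` with the outward-step field (ι) exists on this graph:
**`Lon.isEmpty_planarSkeletonFrm`**, `…Neg`, `…Sign`, `…Conc`.  In diamond every 3-path lies on at most one hexagon and the projection along
`[001]` IS a unit-step chart (`DiamondSkeletonConc`): the eclipsed conformation is exactly what the skeleton interfaces cannot digest.
This sharpens the lane's class-map entry for lonsdaleite ("method-void: no AFFINE chart passes (ι)", P2-LATTICES §49) to ALL charts.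
[cite: KozmaNitzan2024, §4 p. 15 (outward steps), p. 16 (Lemma 8)] [cite: ConwaySloane1999, Ch. 4 §6.1 (hexagonal close packing and its relatives)]
-/

namespace Summit.CriticalPhenomena.PercolationContinuityZ3.Theorems.Transplant

open Literature.Probability.Percolation Literature.Probability.LatticeModels SimpleGraph
open scoped Classical

namespace Lon

/-! ## §1 The lonsdaleite graph on `ℤ³` -/

/-- The sheet class of a site: `m mod 4` ∈ `{0 = D_even, 1 = U_even, 2 = D_odd, 3 = U_odd}`. [folklore] -/
def cls (x : Site 3) : ℤ := x 2 % 4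

/-- The bond vectors from a site of class `c`. [cite: ConwaySloane1999, Ch. 4 §6.1] -/
def bonds (c : ℤ) : Finset (Site 3) :=
  if c = 0 then {![0, 0, -1], ![0, 0, 1], ![0, 1, 1], ![1, 0, 1]}
  else if c = 1 then {![-1, 0, -1], ![0, -1, -1], ![0, 0, -1], ![0, 0, 1]}
  else if c = 2 then {![-1, 0, 1], ![0, -1, 1], ![0, 0, -1], ![0, 0, 1]}
  else {![0, 0, -1], ![0, 0, 1], ![0, 1, -1], ![1, 0, -1]}

/-- `0` is not a bond. [folklore] -/
theorem zero_notMem_bonds : ∀ c : Fin 4, (0 : Site 3) ∉ bonds (c : ℕ) := by decide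

/-- **The bond table is symmetric**: the reverse of a bond from a class-`c` site is a bond from its far end (class `c + v₂ mod 4`). [folklore] -/
theorem neg_mem_bonds : ∀ c : Fin 4, ∀ v ∈ bonds (c : ℕ), -v ∈ bonds ((((c : ℕ) : ℤ) + v 2) % 4) := by decide

/-- Four bonds at every site. [folklore] -/
theorem card_bonds : ∀ c : Fin 4, (bonds (c : ℕ)).card = 4 := by decide

/-- **The lonsdaleite graph.** [cite: ConwaySloane1999, Ch. 4 §6.1] -/
def graph : SimpleGraph (Site 3) := SimpleGraph.fromRel fun x y => y - x ∈ bonds (cls x)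

/-- The class is one of `0, 1, 2, 3`. [folklore] -/
theorem exists_cls_eq (x : Site 3) : ∃ c : Fin 4, ((c : ℕ) : ℤ) = cls x := by
  have h0 : 0 ≤ x 2 % 4 := Int.emod_nonneg _ (by norm_num)
  have h4 : x 2 % 4 < 4 := Int.emod_lt_of_pos _ (by norm_num)
  refine ⟨⟨(x 2 % 4).toNat, by omega⟩, ?_⟩
  show (((x 2 % 4).toNat : ℕ) : ℤ) = x 2 % 4
  omega

/-- The class of the far end of a bond. [folklore] -/
theorem cls_add (x v : Site 3) : cls (x + v) = (cls x + v 2) % 4 := by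
  unfold cls
  rw [Pi.add_apply, Int.emod_add_emod]

/-- **Adjacency: `y − x` is a bond from the class of `x`.** [folklore] -/
theorem adj_iff (x y : Site 3) : graph.Adj x y ↔ y - x ∈ bonds (cls x) := by
  rw [graph, SimpleGraph.fromRel_adj]
  constructor
  · rintro ⟨-, h | h⟩
    · exact h
    · obtain ⟨c, hc⟩ := exists_cls_eq y
      rw [← hc] at h
      have h' := neg_mem_bonds c _ h
      rw [neg_sub, hc] at h'
      have hx : cls x = (cls y + (x - y) 2) % 4 := by
        have := cls_add y (x - y)
        rwa [add_sub_cancel] at this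
      rwa [hx]
  · intro h
    refine ⟨fun hxy => ?_, Or.inl h⟩
    subst hxy
    obtain ⟨c, hc⟩ := exists_cls_eq x
    rw [sub_self, ← hc] at h
    exact zero_notMem_bonds c h

/-- The neighbours of `x` are the `x + v`, `v` a bond. [folklore] -/
theorem neighborSet_eq (x : Site 3) : graph.neighborSet x = ↑((bonds (cls x)).image (x + ·)) := by
  ext y
  rw [SimpleGraph.mem_neighborSet, adj_iff, Finset.coe_image, Set.mem_image]
  constructor
  · intro h; exact ⟨y - x, h, by abel⟩
  · rintro ⟨s, hs, rfl⟩; simpa using hs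

/-- The graph is locally finite. [folklore] -/
noncomputable instance graph_locallyFinite : graph.LocallyFinite := fun x =>
  (((bonds (cls x)).image (x + ·)).finite_toSet.subset (neighborSet_eq x).le).fintype

/-- The neighbour finset is the image of the bond table. [folklore] -/
theorem neighborFinset_eq (x : Site 3) : graph.neighborFinset x = (bonds (cls x)).image (x + ·) := by
  apply Finset.coe_injective
  rw [SimpleGraph.coe_neighborFinset, neighborSet_eq]

/-- **Lonsdaleite is 4-regular.** [cite: ConwaySloane1999, Ch. 4 §6.1] -/
theorem degree_eq (x : Site 3) : graph.degree x = 4 := by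
  obtain ⟨c, hc⟩ := exists_cls_eq x
  rw [← SimpleGraph.card_neighborFinset_eq_degree, neighborFinset_eq, Finset.card_image_of_injective _ (add_right_injective x), ← hc,
    card_bonds]

/-- Adjacency of explicit sites is decided on the bond table. [folklore] -/
theorem adj_of_mem {x y : Site 3} (h : y - x ∈ bonds (cls x)) : graph.Adj x y := (adj_iff x y).2 h

/-! ## §2 The three-path configuration: two boat rings on the eclipsed path `D₀ U₀ D₁ U₁` -/

/-- **The certificate**: the path `(0,0,0) ∼ (0,0,1) ∼ (0,0,2) ∼ (0,0,3)` closes to a hexagon through `(1,0,2), (1,0,1)` AND through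
`(0,1,2), (0,1,1)`. [folklore] -/
noncomputable def threePathConfig : ThreePathConfig graph where
  v₀ := ![0, 0, 0]
  v₁ := ![0, 0, 1]
  v₂ := ![0, 0, 2]
  v₃ := ![0, 0, 3]
  v₄ := ![1, 0, 2]
  v₅ := ![1, 0, 1]
  w₄ := ![0, 1, 2]
  w₅ := ![0, 1, 1]
  h₀₁ := adj_of_mem (by decide)
  h₁₂ := adj_of_mem (by decide)
  h₂₃ := adj_of_mem (by decide)
  h₃₄ := adj_of_mem (by decide)
  h₄₅ := adj_of_mem (by decide)
  h₅₀ := adj_of_mem (by decide)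
  g₃₄ := adj_of_mem (by decide)
  g₄₅ := adj_of_mem (by decide)
  g₅₀ := adj_of_mem (by decide)
  n₀₂ := by decide
  n₁₃ := by decide
  n₂₄ := by decide
  n₃₅ := by decide
  n₄₀ := by decide
  n₅₁ := by decide
  m₂₄ := by decide
  m₃₅ := by decide
  m₄₀ := by decide
  m₅₁ := by decide
  hvw := by decide
  d₀ := (degree_eq _).le
  d₁ := (degree_eq _).le
  d₂ := (degree_eq _).le
  d₃ := (degree_eq _).le
  d₄ := (degree_eq _).le
  d₅ := (degree_eq _).le
  c₄ := (degree_eq _).le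
  c₅ := (degree_eq _).le

/-! ## §3 The kernel method-void certificates -/

/-- **THEOREM (kernel no-go): the lonsdaleite net carries no `PlanarSkeletonFrm`** — no 1-Lipschitz (indeed no) chart `φ : ℤ³ → ℤ²` has the
outward-step field (ι), whatever the base set and the frames; so neither N2 nor U has lonsdaleite as a customer. [cite: KozmaNitzan2024, §4 p. 15] -/
theorem isEmpty_planarSkeletonFrm : IsEmpty (PlanarSkeletonFrm graph) := isEmpty_planarSkeletonFrm_of_threePath threePathConfig

/-- **… no `PlanarSkeletonNeg`** (the `{±1}` interfaces N1 / multi-type). [cite: KozmaNitzan2024, §4 p. 16 (Lemma 8)] -/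
theorem isEmpty_planarSkeletonNeg : IsEmpty (PlanarSkeletonNeg graph) := isEmpty_planarSkeletonNeg_of_threePath threePathConfig

/-- **… no `PlanarSkeletonSign`** (so the CLOSED D″ node `samePDropOfSkeletonSign_holds` does not reach lonsdaleite through any chart).
[cite: KozmaNitzan2024, §4 p. 16 (Lemma 8)] -/
theorem isEmpty_planarSkeletonSign : IsEmpty (PlanarSkeletonSign graph) := isEmpty_planarSkeletonSign_of_threePath threePathConfig

/-- **… and no `PlanarSkeletonConc`** (the node of record). [cite: KozmaNitzan2024, §4 p. 16 (Lemma 8)] -/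
theorem isEmpty_planarSkeletonConc : IsEmpty (PlanarSkeletonConc graph) := isEmpty_planarSkeletonConc_of_threePath threePathConfig

/-- **… no `PlanarSkeletonFrmFrom`** (the universal one-type node U's interface: unit steps, cylinders from some width on). [cite: KozmaNitzan2024, §4 p. 15] -/
theorem isEmpty_planarSkeletonFrmFrom : IsEmpty (PlanarSkeletonFrmFrom graph) := ⟨fun Φ => threePathConfig.false_of_unitSteps Φ.step⟩

/-- **… and no `PlanarSkeletonFrmScaled` — for ANY step length `N` and ANY Lipschitz constant**: the coarse chart `⌊φ/N⌋` of a scaled skeleton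
has unit steps (`PlanarSkeletonFrmScaled.steps_coarse`) and the certificate uses nothing but the steps.  So not even a multi-type version of the
scaled node `U_s` could reach lonsdaleite: what it lacks is a step along SINGLE edges, i.e. it needs QUASI-steps. [cite: KozmaNitzan2024, §4 p. 15] -/
theorem isEmpty_planarSkeletonFrmScaled : IsEmpty (PlanarSkeletonFrmScaled graph) :=
  ⟨fun Φ => threePathConfig.false_of_unitSteps Φ.steps_coarse⟩

end Lon

end Summit.CriticalPhenomena.PercolationContinuityZ3.Theorems.Transplant
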